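import Mathlib.RingTheory.AdicCompletion.Basic
import Mathlib.LinearAlgebra.Matrix.NonsingularInverse
import Mathlib.RingTheory.Ideal.Quotient.Operations
import Mathlib.RingTheory.LocalRing.MaximalIdeal.Basic
import HarnessLib

/-!
# Hensel lifting for hermitian ∕ unitary matrix equations `ᵗ(τG) · J · G = J` over an adically complete local ring

Topic `LinearAlgebra/Matrix`; namespace `Literature.LinearAlgebra.Matrix`.  THEOREMS ONLY (no definition, no instance, no notation,
no named fact, no `sorry`; the entrywise-ideal bookkeeping lemmas are `private`); Mathlib only.  Cell `hodgecm-mathlib`, F0∕P3a road D-T «volumes ∕ Tamagawa numbers», brick «D-T1u-Hensel»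
(LEAD F0P3a-plan (g7) T6-99 (2); seat B-p14 (g29)): the GENERIC successive-approximation lemma behind the surjectivity of reduction
modulo `𝔭` on the integral points `U(J)(𝒪)` of a unitary group at an unramified place (the «Hensel ∕ smoothness» input named `hsurj`
in D-T1u `Automorphic/UnitaryGroupIntegralPointsReduction`), stated for an arbitrary commutative LOCAL ring `R` that is complete for its
maximal ideal `𝓂` (Mathlib `IsAdicComplete (maximalIdeal R) R` — for the valuation ring of a non-archimedean local field this is
Mathlib's `instance : IsAdicComplete 𝓂[K] 𝒪[K]`, `NumberTheory/LocalField/Basic`), a ring endomorphism `τ` of `R` with `τ ∘ τ = id`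
(the integral Galois involution; `τ = id` is allowed: orthogonal groups), and a `τ`-hermitian matrix `J` (`ᵗ(τJ) = J`) with unit
determinant.

THE STATEMENT (`exists_formPreserving_lift`).  Under the GRADED-TRACE HYPOTHESIS
`hgt : ∀ k (e : R), e ∈ 𝓂^k → τ e = e → ∃ z ∈ 𝓂^k, z + τ z − e ∈ 𝓂^(k+1)` («every `τ`-fixed element of `𝓂^k` is a trace `z + τz`
modulo `𝓂^(k+1)`»), every APPROXIMATE solution `G₀ ∈ Mₙ(R)` of `ᵗ(τG)·J·G = J` modulo `𝓂` lifts to an EXACT solution `G` with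
`G ≡ G₀ (mod 𝓂)` entrywise.  The hypothesis is discharged (`gradedTrace_of_fixed_generator`) when `𝓂 = (ϖ)` is principal with a
`τ`-FIXED generator `ϖ` in a domain and the residue-level trace statement `∀ a, τ a ≡ a (mod 𝓂) → ∃ b, b + τ b ≡ a (mod 𝓂)` holds — at an
inert place of a quadratic extension `E/F` (`ϖ ∈ F`, `τ̄ =` Frobenius, trace `𝔽_{q²} → 𝔽_q` onto) and for `τ = id` with `2 ∈ Rˣ`.

THE PROOF (successive approximation, [PlatonovRapinchuk1994, §3.3 (Hensel's lemma for `G_𝒪`, reduction modulo `𝔭^a`)]; no smoothness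
theory is invoked).  If `ᵗ(τG)JG = J + E` with `E ∈ Mₙ(𝓂^(k+1))` then `E` is EXACTLY `τ`-hermitian, `A := ᵗ(τG)J ∈ GLₙ(R)` (the determinant
of an approximate solution is a unit because `det J` is), and for `G′ := G − A⁻¹Z` one has
`ᵗ(τG′)JG′ − J = −((Z + ᵗ(τZ)) − E) + ᵗ(τD)JD` (`D := A⁻¹Z`), so it suffices to solve `Z + ᵗ(τZ) ≡ E (mod 𝓂^(k+2))` with
`Z ∈ Mₙ(𝓂^(k+1))`: off the diagonal take the strict upper triangle of `E` (exact by hermitian symmetry), on the diagonal use `hgt`.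
The corrections are entrywise Cauchy for the `𝓂`-adic filtration; `IsPrecomplete` gives the limit and `IsHausdorff` makes the limiting
identity exact.  Index type: any finite linearly ordered `n` (the order only selects the upper triangle).

NOT HERE: the local-field instantiation and the `GLₙ(E)`-level statement (sibling «D-T1u-Hensel» FILE B
`NumberTheory/Automorphic/UnitaryGroupIntegralPointsHensel`); the ramified case with NO `τ`-fixed uniformizer (`τϖ = −ϖ`; same iteration
with a Hilbert-90 twist — a later edition); smoothness of the group scheme `U_J`.  HC_CM is proved only modulo the printed citations until
rung 0 closes; this file is unconditional and generic (count-neutral, D-T road).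

## References
* [PlatonovRapinchuk1994] V. Platonov, A. Rapinchuk, *Algebraic Groups and Number Theory* (1994), §3.3 (Hensel's lemma; reduction of
  `G_𝒪` modulo `𝔭^a` is onto the points of the reduction for smooth `G`), §5.1.
* [Tits1979] J. Tits, *Reductive groups over local fields*, PSPM 33.1 (1979), §3.8 (hyperspecial `U(J)(𝒪_v)` at unramified `v`).
-/

set_option autoImplicit false

open IsLocalRing Matrix
open scoped Matrix

namespace Literature.LinearAlgebra.Matrix

section General

variable {R : Type*} [CommRing R] (τ : R →+* R) {n : Type*}

/-- `ᵗ(τ ᵗ(τM)) = M` for an involutive `τ`. [folklore] -/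
private theorem transpose_map_transpose_map (hτ : ∀ x, τ (τ x) = x) (M : Matrix n n R) : ((M.map τ)ᵀ.map τ)ᵀ = M := by
  ext i j
  simp [hτ]

variable [Fintype n]

/-- `ᵗ(τ(M N)) = ᵗ(τN) ᵗ(τM)`. [folklore] -/
private theorem transpose_map_mul' (M N : Matrix n n R) : ((M * N).map τ)ᵀ = (N.map τ)ᵀ * (M.map τ)ᵀ := by
  rw [Matrix.map_mul, Matrix.transpose_mul]

/-- If every entry of `M` lies in the ideal `𝔞`, so does every entry of `M * N`. [folklore] -/
private theorem mul_apply_mem_of_left {𝔞 : Ideal R} {M : Matrix n n R} (N : Matrix n n R) (hM : ∀ i j, M i j ∈ 𝔞) (i j : n) :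
    (M * N) i j ∈ 𝔞 := by
  rw [Matrix.mul_apply]
  exact sum_mem fun k _ => Ideal.mul_mem_right _ _ (hM i k)

/-- If every entry of `N` lies in the ideal `𝔞`, so does every entry of `M * N`. [folklore] -/
private theorem mul_apply_mem_of_right {𝔞 : Ideal R} (M : Matrix n n R) {N : Matrix n n R} (hN : ∀ i j, N i j ∈ 𝔞) (i j : n) :
    (M * N) i j ∈ 𝔞 := by
  rw [Matrix.mul_apply]
  exact sum_mem fun k _ => Ideal.mul_mem_left _ _ (hN k j)

/-- Entries in `𝔞` times entries in `𝔟` gives entries in `𝔞 * 𝔟`. [folklore] -/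
private theorem mul_apply_mem_mul {𝔞 𝔟 : Ideal R} {M N : Matrix n n R} (hM : ∀ i j, M i j ∈ 𝔞) (hN : ∀ i j, N i j ∈ 𝔟) (i j : n) :
    (M * N) i j ∈ 𝔞 * 𝔟 := by
  rw [Matrix.mul_apply]
  exact sum_mem fun k _ => Ideal.mul_mem_mul (hM i k) (hN k j)

/-- Entrywise congruence modulo `𝔞` passes to determinants. [folklore] -/
private theorem det_sub_det_mem [DecidableEq n] {𝔞 : Ideal R} {M N : Matrix n n R} (h : ∀ i j, M i j - N i j ∈ 𝔞) :
    M.det - N.det ∈ 𝔞 := by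
  rw [← Ideal.Quotient.eq, RingHom.map_det, RingHom.map_det]
  congr 1
  ext i j
  exact Ideal.Quotient.eq.2 (h i j)

/-- A ring endomorphism mapping `𝔞` into itself preserves `𝔞 ^ k`. [folklore] -/
private theorem map_mem_pow_of_map_mem {𝔞 : Ideal R} (hτ : ∀ x ∈ 𝔞, τ x ∈ 𝔞) {k : ℕ} {x : R} (hx : x ∈ 𝔞 ^ k) :
    τ x ∈ 𝔞 ^ k := by
  have hle : Ideal.map τ 𝔞 ≤ 𝔞 := (Ideal.map_le_iff_le_comap).2 fun y hy => hτ y hy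
  have : τ x ∈ Ideal.map τ (𝔞 ^ k) := Ideal.mem_map_of_mem τ hx
  rw [Ideal.map_pow] at this
  exact Ideal.pow_right_mono hle k this

end General

section Local

variable {R : Type*} [CommRing R] [IsLocalRing R] (τ : R →+* R)
variable {n : Type*} [Fintype n] [DecidableEq n]

/-- An involutive ring endomorphism of a local ring maps the maximal ideal into itself. [folklore] -/
private theorem map_mem_maximalIdeal_of_involutive (hτ : ∀ x, τ (τ x) = x) {x : R} (hx : x ∈ maximalIdeal R) :
    τ x ∈ maximalIdeal R := by
  rw [IsLocalRing.mem_maximalIdeal, mem_nonunits_iff] at hx ⊢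
  intro hu
  exact hx (by simpa [hτ] using hu.map τ)

/-- The determinant of an approximate solution of `ᵗ(τG) J G = J` modulo `𝓂` is a unit (because `det J` is). [cite: PlatonovRapinchuk1994, §3.3] -/
theorem isUnit_det_of_formPreserving_mod (J G : Matrix n n R) (hJu : IsUnit J.det)
    (h : ∀ i j, ((G.map τ)ᵀ * J * G - J) i j ∈ maximalIdeal R) : IsUnit G.det := by
  by_contra hG
  have hGm : G.det ∈ maximalIdeal R := (IsLocalRing.mem_maximalIdeal _).2 hG
  have hdet : ((G.map τ)ᵀ * J * G).det - J.det ∈ maximalIdeal R :=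
    det_sub_det_mem fun i j => by simpa [Matrix.sub_apply] using h i j
  have hprod : ((G.map τ)ᵀ * J * G).det ∈ maximalIdeal R := by
    rw [Matrix.det_mul]
    exact Ideal.mul_mem_left _ _ hGm
  have hJm : J.det ∈ maximalIdeal R := by
    have := Ideal.sub_mem _ hprod hdet
    simpa using this
  exact ((IsLocalRing.mem_maximalIdeal _).1 hJm) hJu

variable [LinearOrder n]

/-- **One step of the successive approximation.**  If `ᵗ(τG) J G ≡ J (mod 𝓂^(k+1))` entrywise (with `J` `τ`-hermitian of unit
determinant, `τ` involutive, and the graded-trace hypothesis at level `k+1`), there is `G′ ≡ G (mod 𝓂^(k+1))` with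
`ᵗ(τG′) J G′ ≡ J (mod 𝓂^(k+2))`. [cite: PlatonovRapinchuk1994, §3.3] -/
theorem exists_formPreserving_lift_step (hτ : ∀ x, τ (τ x) = x) (J : Matrix n n R) (hJ : (J.map τ)ᵀ = J) (hJu : IsUnit J.det)
    (k : ℕ)
    (hgt : ∀ e : R, e ∈ maximalIdeal R ^ (k + 1) → τ e = e →
      ∃ z ∈ maximalIdeal R ^ (k + 1), z + τ z - e ∈ maximalIdeal R ^ (k + 2))
    (G : Matrix n n R) (hGu : IsUnit G.det) (hG : ∀ i j, ((G.map τ)ᵀ * J * G - J) i j ∈ maximalIdeal R ^ (k + 1)) :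
    ∃ G' : Matrix n n R, (∀ i j, (G' - G) i j ∈ maximalIdeal R ^ (k + 1)) ∧
      ∀ i j, ((G'.map τ)ᵀ * J * G' - J) i j ∈ maximalIdeal R ^ (k + 2) := by
  -- the defect and its hermitian symmetry
  set E : Matrix n n R := (G.map τ)ᵀ * J * G - J with hEdef
  have hEherm : (E.map τ)ᵀ = E := by
    rw [hEdef, Matrix.map_sub τ (map_sub τ), Matrix.transpose_sub, transpose_map_mul' τ, transpose_map_mul' τ,
      transpose_map_transpose_map τ hτ, hJ, Matrix.mul_assoc]
  have hEentry : ∀ i j, τ (E j i) = E i j := fun i j => by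
    have := congrFun (congrFun hEherm i) j
    simpa [Matrix.transpose_apply, Matrix.map_apply] using this
  -- diagonal corrections from the graded-trace hypothesis
  have hdiag : ∀ i, ∃ z ∈ maximalIdeal R ^ (k + 1), z + τ z - E i i ∈ maximalIdeal R ^ (k + 2) :=
    fun i => hgt (E i i) (hG i i) (hEentry i i)
  choose z hz hz' using hdiag
  -- the correction `Z`: strict upper triangle of `E`, the chosen `z` on the diagonal, zero below
  let Z : Matrix n n R := Matrix.of fun i j => if i < j then E i j else if i = j then z i else 0
  have hZmem : ∀ i j, Z i j ∈ maximalIdeal R ^ (k + 1) := by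
    intro i j
    simp only [Z, Matrix.of_apply]
    split_ifs with h1 h2
    · exact hG i j
    · exact hz i
    · exact Ideal.zero_mem _
  have hZsum : ∀ i j, (Z + (Z.map τ)ᵀ - E) i j ∈ maximalIdeal R ^ (k + 2) := by
    intro i j
    simp only [Matrix.sub_apply, Matrix.add_apply, Matrix.transpose_apply, Matrix.map_apply, Z, Matrix.of_apply]
    rcases lt_trichotomy i j with hij | rfl | hji
    · have h1 : ¬ j < i := not_lt.2 hij.le
      have h2 : j ≠ i := ne_of_gt hij
      simp only [hij, if_true, h1, if_false, h2, map_zero, add_zero, sub_self]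
      exact Ideal.zero_mem _
    · simp only [lt_irrefl, if_false, if_true]
      exact hz' i
    · have h1 : ¬ i < j := not_lt.2 hji.le
      have h2 : i ≠ j := ne_of_gt hji
      simp only [h1, if_false, h2, hji, if_true, zero_add, hEentry i j, sub_self]
      exact Ideal.zero_mem _
  -- `A := ᵗ(τG) J` is invertible
  set A : Matrix n n R := (G.map τ)ᵀ * J with hAdef
  have hAu : IsUnit A.det := by
    rw [hAdef, Matrix.det_mul, Matrix.det_transpose]
    refine IsUnit.mul ?_ hJu
    have : (G.map τ).det = τ G.det := by rw [RingHom.map_det]; rfl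
    rw [this]
    exact hGu.map τ
  -- the corrected matrix
  set D : Matrix n n R := A⁻¹ * Z with hDdef
  have hAD : A * D = Z := by
    rw [hDdef, ← Matrix.mul_assoc, Matrix.mul_nonsing_inv A hAu, Matrix.one_mul]
  have hDmem : ∀ i j, D i j ∈ maximalIdeal R ^ (k + 1) := fun i j => by
    rw [hDdef]; exact mul_apply_mem_of_right _ hZmem i j
  have hτm : ∀ x ∈ maximalIdeal R, τ x ∈ maximalIdeal R := fun x hx => map_mem_maximalIdeal_of_involutive τ hτ hx
  have hDtmem : ∀ i j, (D.map τ)ᵀ i j ∈ maximalIdeal R ^ (k + 1) := fun i j => by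
    simpa [Matrix.transpose_apply, Matrix.map_apply] using map_mem_pow_of_map_mem τ hτm (hDmem j i)
  refine ⟨G - D, fun i j => by simpa using (Ideal.neg_mem_iff _).2 (hDmem i j), fun i j => ?_⟩
  -- the identity `ᵗ(τ(G − D)) J (G − D) − J = −((Z + ᵗ(τZ)) − E) + ᵗ(τD) J D`
  have hDJG : (D.map τ)ᵀ * J * G = ((A * D).map τ)ᵀ := by
    rw [transpose_map_mul' τ A D, hAdef, transpose_map_mul' τ _ J, transpose_map_transpose_map τ hτ, hJ, Matrix.mul_assoc]
  have hident : ((G - D).map τ)ᵀ * J * (G - D) - J = -(Z + (Z.map τ)ᵀ - E) + (D.map τ)ᵀ * J * D := by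
    have h1 : (G.map τ)ᵀ * J * D = Z := by rw [← hAD, hAdef]
    rw [Matrix.map_sub τ (map_sub τ), Matrix.transpose_sub, Matrix.sub_mul, Matrix.sub_mul, Matrix.mul_sub, Matrix.mul_sub, h1, hDJG,
      hAD, hEdef]
    abel
  rw [hident, Matrix.add_apply, Matrix.neg_apply]
  refine Ideal.add_mem _ ((Ideal.neg_mem_iff _).2 (hZsum i j)) ?_
  -- `ᵗ(τD) J D` has entries in `𝓂^(k+1) · 𝓂^(k+1) ⊆ 𝓂^(k+2)`
  have hprod : ((D.map τ)ᵀ * J * D) i j ∈ maximalIdeal R ^ (k + 1) * maximalIdeal R ^ (k + 1) :=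
    mul_apply_mem_mul (fun i j => mul_apply_mem_of_left J hDtmem i j) hDmem i j
  rw [← pow_add] at hprod
  exact Ideal.pow_le_pow_right (by omega) hprod

/-- **Hensel lifting for `ᵗ(τG) J G = J`.**  `R` a local ring complete for `𝓂 = maximalIdeal R`, `τ` an involutive ring
endomorphism, `J` `τ`-hermitian with unit determinant, and the graded-trace hypothesis `hgt`; then every `G₀` with
`ᵗ(τG₀) J G₀ ≡ J (mod 𝓂)` entrywise is congruent modulo `𝓂` to an exact solution `G` of `ᵗ(τG) J G = J` (whose determinant is
then a unit, `isUnit_det_of_formPreserving_mod`). [cite: PlatonovRapinchuk1994, §3.3] -/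
theorem exists_formPreserving_lift [IsAdicComplete (maximalIdeal R) R] (hτ : ∀ x, τ (τ x) = x)
    (hgt : ∀ (k : ℕ) (e : R), e ∈ maximalIdeal R ^ k → τ e = e →
      ∃ z ∈ maximalIdeal R ^ k, z + τ z - e ∈ maximalIdeal R ^ (k + 1))
    (J : Matrix n n R) (hJ : (J.map τ)ᵀ = J) (hJu : IsUnit J.det)
    (G₀ : Matrix n n R) (h₀ : ∀ i j, ((G₀.map τ)ᵀ * J * G₀ - J) i j ∈ maximalIdeal R) :
    ∃ G : Matrix n n R, (G.map τ)ᵀ * J * G = J ∧ ∀ i j, (G - G₀) i j ∈ maximalIdeal R := by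
  -- invariant at level `k`: `G ≡ G₀ (mod 𝓂)` and `ᵗ(τG) J G ≡ J (mod 𝓂^(k+1))`
  let P : ℕ → Matrix n n R → Prop := fun k G =>
    (∀ i j, (G - G₀) i j ∈ maximalIdeal R) ∧ ∀ i j, ((G.map τ)ᵀ * J * G - J) i j ∈ maximalIdeal R ^ (k + 1)
  have hP0 : P 0 G₀ := ⟨fun i j => by simp, fun i j => by simpa using h₀ i j⟩
  have hdetP : ∀ k G, P k G → IsUnit G.det := by
    intro k G hG
    have hG₀u : IsUnit G₀.det := isUnit_det_of_formPreserving_mod τ J G₀ hJu h₀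
    have hd : G.det - G₀.det ∈ maximalIdeal R := det_sub_det_mem fun i j => by simpa [Matrix.sub_apply] using hG.1 i j
    by_contra hGu
    have hGm : G.det ∈ maximalIdeal R := (IsLocalRing.mem_maximalIdeal _).2 hGu
    have : G₀.det ∈ maximalIdeal R := by simpa using Ideal.sub_mem _ hGm hd
    exact ((IsLocalRing.mem_maximalIdeal _).1 this) hG₀u
  have hstep : ∀ k (G : {G : Matrix n n R // P k G}), ∃ G' : {G' : Matrix n n R // P (k + 1) G'},
      ∀ i j, (G'.1 - G.1) i j ∈ maximalIdeal R ^ (k + 1) := by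
    intro k G
    obtain ⟨G', hG'G, hG'⟩ := exists_formPreserving_lift_step τ hτ J hJ hJu k (hgt (k + 1)) G.1 (hdetP k G.1 G.2) G.2.2
    refine ⟨⟨G', fun i j => ?_, hG'⟩, hG'G⟩
    have h1 : (G' - G.1) i j ∈ maximalIdeal R := Ideal.pow_le_self (Nat.succ_ne_zero k) (hG'G i j)
    have h2 := G.2.1 i j
    have : (G' - G₀) i j = (G' - G.1) i j + (G.1 - G₀) i j := by simp [Matrix.sub_apply]
    rw [this]
    exact Ideal.add_mem _ h1 h2
  choose next hnext using hstep
  -- the sequence of approximations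
  let seq : (k : ℕ) → {G : Matrix n n R // P k G} := fun k => Nat.rec ⟨G₀, hP0⟩ (fun k G => next k G) k
  have hseq_succ : ∀ k, seq (k + 1) = next k (seq k) := fun k => rfl
  -- Cauchy estimates: `seq m ≡ seq m' (mod 𝓂^(m+1))` for `m ≤ m'`
  have hcauchy : ∀ m d i j, ((seq (m + d)).1 - (seq m).1) i j ∈ maximalIdeal R ^ (m + 1) := by
    intro m d
    induction d with
    | zero => intro i j; simp
    | succ d ih =>
      intro i j
      have h1 : ((seq (m + d + 1)).1 - (seq (m + d)).1) i j ∈ maximalIdeal R ^ (m + 1) := by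
        rw [hseq_succ]
        exact Ideal.pow_le_pow_right (by omega) (hnext (m + d) (seq (m + d)) i j)
      have : ((seq (m + (d + 1))).1 - (seq m).1) i j =
          ((seq (m + d + 1)).1 - (seq (m + d)).1) i j + ((seq (m + d)).1 - (seq m).1) i j := by
        rw [show m + (d + 1) = m + d + 1 from rfl]
        simp [Matrix.sub_apply]
      rw [this]
      exact Ideal.add_mem _ h1 (ih i j)
  -- entrywise limits
  have hlim : ∀ i j, ∃ L : R, ∀ m, (seq m).1 i j - L ∈ maximalIdeal R ^ m := by
    intro i j
    have hf : ∀ {m m'}, m ≤ m' → (seq m).1 i j ≡ (seq m').1 i j [SMOD (maximalIdeal R ^ m • ⊤ : Submodule R R)] := by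
      intro m m' hmm'
      obtain ⟨d, rfl⟩ := Nat.exists_eq_add_of_le hmm'
      rw [SModEq.sub_mem, smul_eq_mul, Ideal.mul_top]
      have := (Ideal.neg_mem_iff _).2 (hcauchy m d i j)
      have h' : -(((seq (m + d)).1 - (seq m).1) i j) = (seq m).1 i j - (seq (m + d)).1 i j := by simp [Matrix.sub_apply]
      rw [h'] at this
      exact Ideal.pow_le_pow_right (Nat.le_succ m) this
    obtain ⟨L, hL⟩ := IsPrecomplete.prec' (I := maximalIdeal R) (fun m => (seq m).1 i j) hf
    refine ⟨L, fun m => ?_⟩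
    have := hL m
    rwa [SModEq.sub_mem, smul_eq_mul, Ideal.mul_top] at this
  choose L hL using hlim
  let G : Matrix n n R := Matrix.of fun i j => L i j
  have hGseq : ∀ m i j, ((seq m).1 - G) i j ∈ maximalIdeal R ^ m := fun m i j => by
    simpa [G, Matrix.sub_apply] using hL i j m
  have hτm : ∀ x ∈ maximalIdeal R, τ x ∈ maximalIdeal R := fun x hx => map_mem_maximalIdeal_of_involutive τ hτ hx
  refine ⟨G, ?_, fun i j => ?_⟩
  · -- exactness by the Hausdorff property: the defect of `G` lies in every `𝓂^m`
    rw [← sub_eq_zero]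
    ext i j
    refine IsHausdorff.haus' (I := maximalIdeal R) _ fun m => ?_
    rw [SModEq.sub_mem, sub_zero, smul_eq_mul, Ideal.mul_top]
    -- compare with the `m`-th approximation
    have hm1 : ∀ a b, ((seq m).1 - G) a b ∈ maximalIdeal R ^ m := hGseq m
    have hA : ∀ a b, (((seq m).1.map τ)ᵀ * J * (seq m).1 - (G.map τ)ᵀ * J * G) a b ∈ maximalIdeal R ^ m := by
      intro a b
      have hsplit : ((seq m).1.map τ)ᵀ * J * (seq m).1 - (G.map τ)ᵀ * J * G =
          (((seq m).1 - G).map τ)ᵀ * J * (seq m).1 + (G.map τ)ᵀ * J * ((seq m).1 - G) := by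
        rw [Matrix.map_sub τ (map_sub τ), Matrix.transpose_sub, Matrix.sub_mul, Matrix.sub_mul, Matrix.mul_sub]
        abel
      rw [hsplit, Matrix.add_apply]
      refine Ideal.add_mem _ ?_ (mul_apply_mem_of_right _ hm1 a b)
      have ht : ∀ a b, ((((seq m).1 - G).map τ)ᵀ) a b ∈ maximalIdeal R ^ m := fun a b => by
        simpa [Matrix.transpose_apply, Matrix.map_apply] using map_mem_pow_of_map_mem τ hτm (hm1 b a)
      exact mul_apply_mem_of_left _ (fun a b => mul_apply_mem_of_left J ht a b) a b
    have hB : (((seq m).1.map τ)ᵀ * J * (seq m).1 - J) i j ∈ maximalIdeal R ^ m :=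
      Ideal.pow_le_pow_right (Nat.le_succ m) ((seq m).2.2 i j)
    have : ((G.map τ)ᵀ * J * G - J) i j =
        (((seq m).1.map τ)ᵀ * J * (seq m).1 - J) i j - (((seq m).1.map τ)ᵀ * J * (seq m).1 - (G.map τ)ᵀ * J * G) i j := by
      simp [Matrix.sub_apply]
    rw [this]
    exact Ideal.sub_mem _ hB (hA i j)
  · -- `G ≡ seq 1 ≡ G₀ (mod 𝓂)`
    have h1 : ((seq 1).1 - G) i j ∈ maximalIdeal R := by simpa using hGseq 1 i j
    have h2 : ((seq 1).1 - G₀) i j ∈ maximalIdeal R := (seq 1).2.1 i j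
    have : (G - G₀) i j = ((seq 1).1 - G₀) i j - ((seq 1).1 - G) i j := by simp [Matrix.sub_apply]
    rw [this]
    exact Ideal.sub_mem _ h2 h1

/-- **The graded-trace hypothesis from a `τ`-fixed generator of `𝓂`.**  If `R` is a domain, `𝓂 = (ϖ)` with `τ ϖ = ϖ`, and the
residue-level trace statement `∀ a, τ a − a ∈ 𝓂 → ∃ b, b + τ b − a ∈ 𝓂` holds, then every `τ`-fixed `e ∈ 𝓂^k` is a trace
`z + τ z` modulo `𝓂^(k+1)` with `z ∈ 𝓂^k`.  (Inert place: `ϖ ∈ F_v`, trace `𝔽_{q²} → 𝔽_q` onto; `τ = id`: `2b ≡ a`, needs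
`2 ∈ Rˣ`.) [cite: PlatonovRapinchuk1994, §3.3] -/
theorem gradedTrace_of_fixed_generator [IsDomain R] (ϖ : R) (hϖ : maximalIdeal R = Ideal.span {ϖ}) (hτϖ : τ ϖ = ϖ)
    (hres : ∀ a : R, τ a - a ∈ maximalIdeal R → ∃ b : R, b + τ b - a ∈ maximalIdeal R)
    (k : ℕ) (e : R) (he : e ∈ maximalIdeal R ^ k) (hτe : τ e = e) :
    ∃ z ∈ maximalIdeal R ^ k, z + τ z - e ∈ maximalIdeal R ^ (k + 1) := by
  have hk : maximalIdeal R ^ k = Ideal.span {ϖ ^ k} := by rw [hϖ, Ideal.span_singleton_pow]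
  have hk1 : maximalIdeal R ^ (k + 1) = Ideal.span {ϖ ^ k} * maximalIdeal R := by rw [pow_succ, hk]
  rw [hk] at he
  obtain ⟨e', rfl⟩ := Ideal.mem_span_singleton'.1 he
  by_cases hϖ0 : ϖ ^ k = 0
  · exact ⟨0, Ideal.zero_mem _, by simp [hϖ0]⟩
  -- `τ e' = e'` by cancelling `ϖ ^ k`
  have hτe' : τ e' = e' := by
    have h1 : τ (e' * ϖ ^ k) = τ e' * ϖ ^ k := by rw [map_mul, map_pow, hτϖ]
    rw [h1] at hτe
    exact mul_right_cancel₀ hϖ0 hτe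
  obtain ⟨b, hb⟩ := hres e' (by simp [hτe'])
  refine ⟨b * ϖ ^ k, hk ▸ Ideal.mem_span_singleton'.2 ⟨b, rfl⟩, ?_⟩
  have : b * ϖ ^ k + τ (b * ϖ ^ k) - e' * ϖ ^ k = ϖ ^ k * (b + τ b - e') := by
    rw [map_mul, map_pow, hτϖ]; ring
  rw [this, hk1]
  exact Ideal.mul_mem_mul (Ideal.mem_span_singleton_self _) hb

end Local

end Literature.LinearAlgebra.Matrix
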